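import Summits.RiemannHypothesis.RiemannHypothesis.Theorems.WeilFormatCPolyWindowMixedArch
import Summits.RiemannHypothesis.RiemannHypothesis.Theorems.WeilFormatCKernelEnvelopeArch
import Summits.RiemannHypothesis.RiemannHypothesis.Theorems.WeilFormatCArchSectorEntries
import HarnessLib

/-!
# Format C, design C∞: explicit bounds for the two archimedean families of the mixed entries

Route context: Fourier–Galerkin / Schur-complement certificates of Weil positivity on a window ("format C";
cell memo `run/shared/lean/pub/rh-explicit/rh-explicit-weil-10/KERNEL-LEVER.md` §18–§19 addendum (the `Uq` tail); supporting
stmt-RiemannHypothesis-0098; seat rh-explicit-weil-10).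

The closed form of the mixed entries `W_a(1x^j, χ_m)` (`weilWindowSesq_indicator_pow_chi`) carries, besides powers of
`ω_m^{-1}` and trigonometric families, exactly two non-elementary `m`-families: the archimedean sine integral
`J_s(m) = ∫_{(0,2a]} ρ(t) sin(ω_m t) dt` and the modulation cost `J_c(m) = ∫_{(0,2a]} ρ(t)(1 − cos ω_m t) dt`.  Every tail
treatment of the C∞ coupling needs EXPLICIT bounds on them; here they are, from the landed closed forms
(`setIntegral_weilArchDensity_mul_sin`, `setIntegral_weilArchDensity_mul_one_sub_cos`) and the kernel-envelope bounds:

* `abs_setIntegral_weilArchDensity_mul_sin_le` — `|J_s(m)| ≤ (2 + π/2)/2 + e^{−a}/(1 − e^{−4a})` for EVERY `m`;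
* `setIntegral_weilArchDensity_mul_one_sub_cos_nonneg`, `…_le` — `0 ≤ J_c(m) + (tail ≤ 2E)` bookkeeping:
  `|J_c(m)| ≤ (log(5/4 + |ω_m|/2) + 8 − Re ψ(¼))/2 + 2E` for `|ω_m| ≥ 1`, `E = Σ_k e^{−2a l_k} = weilArchDensity (2a)`
  (the `log m` growth of the Re ψ family, `norm_digamma_le_log`).

Elementary given the tree; standard axioms; no definitions; no RH claim.
-/

set_option autoImplicit false
-- `Summit.RiemannHypothesis.RiemannHypothesis.…` is the layout-mandated namespace (summit = problem name).
set_option linter.dupNamespace false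

noncomputable section

open Complex Filter Set MeasureTheory
open scoped Real Topology ComplexConjugate

namespace Summit.RiemannHypothesis.RiemannHypothesis.Theorems.WeilFormatC

open Literature.NumberTheory.LFunctions Literature.NumberTheory.LFunctions.Yoshida1992
open Literature.Analysis.SpecialFunctions Literature.Analysis.SpecialFunctions.Complex

variable {a : ℝ}

/-- **The archimedean sine family is bounded**: `|∫_{(0,2a]} ρ(t) sin(ω_m t) dt| ≤ (2 + π/2)/2 + e^{−a}/(1 − e^{−4a})`
for every mode `m` (`a > 0`). -/
theorem abs_setIntegral_weilArchDensity_mul_sin_le (ha : 0 < a) (m : ℤ) :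
    |∫ t in Ioc 0 (2 * a), weilArchDensity t * Real.sin (π * m / a * t)|
      ≤ (2 + π / 2) / 2 + Real.exp (-a) / (1 - Real.exp (-(4 * a))) := by
  rw [setIntegral_weilArchDensity_mul_sin ha m]
  have hS : ∑' k : ℕ, Real.exp (-(2 * a * digammaNode k)) * ((π * m / a) / (digammaNode k ^ 2 + (π * m / a) ^ 2))
      = archExpSumSin a m := by
    unfold archExpSumSin freq
    rfl
  rw [hS]
  have h1 := abs_im_digamma_freq_le a m
  have h2 := abs_archExpSumSin_le ha m
  have e : (Complex.digamma (1 / 4 + ((π * m / a : ℝ) : ℂ) / 2 * I)) = Complex.digamma (1 / 4 + ((freq a m : ℝ) : ℂ) / 2 * I) := by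
    unfold freq; rfl
  rw [e]
  have t := abs_sub ((Complex.digamma (1 / 4 + ((freq a m : ℝ) : ℂ) / 2 * I)).im / 2) (archExpSumSin a m)
  have h1' : |(Complex.digamma (1 / 4 + ((freq a m : ℝ) : ℂ) / 2 * I)).im / 2| ≤ (2 + π / 2) / 2 := by
    rw [abs_div, abs_two]; linarith
  linarith

/-- `Re ψ(¼ + iω/2) ≤ log(5/4 + |ω|/2) + 8` for `|ω| ≥ 1` (`norm_digamma_le_log`). -/
theorem reDigammaQuarter_le_log {ω : ℝ} (hω : 1 ≤ |ω|) :
    reDigammaQuarter ω ≤ Real.log (5 / 4 + |ω| / 2) + 8 := by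
  set w : ℂ := 1 / 4 + (ω : ℂ) / 2 * I with hw
  have hre : w.re = 1 / 4 := by simp [hw]
  have him : w.im = ω / 2 := by simp [hw]
  have h := norm_digamma_le_log (w := w) (by rw [hre]; norm_num) (by rw [him, abs_div, abs_two]; linarith)
  have hn : ‖w‖ ≤ 1 / 4 + |ω| / 2 := by
    have h1 : ‖w‖ ≤ |w.re| + |w.im| := Complex.norm_le_abs_re_add_abs_im w
    rw [hre, him] at h1
    have e1 : |(1 / 4 : ℝ)| = 1 / 4 := abs_of_pos (by norm_num)
    have e2 : |ω / 2| = |ω| / 2 := by rw [abs_div, abs_two]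
    linarith
  have hlog : Real.log (1 + ‖w‖) ≤ Real.log (5 / 4 + |ω| / 2) :=
    Real.log_le_log (by positivity) (by linarith)
  have hre' : reDigammaQuarter ω = (Complex.digamma w).re := rfl
  rw [hre']
  exact ((Complex.re_le_norm _).trans h).trans (by linarith)

/-- **The modulation-cost family grows at most logarithmically**: for `|ω_m| ≥ 1` (`ω_m = πm/a`, `a > 0`),
`|∫_{(0,2a]} ρ(t)(1 − cos ω_m t) dt| ≤ (log(5/4 + |ω_m|/2) + 8 − Re ψ(¼))/2 + 2·weilArchDensity(2a)`. -/
theorem abs_setIntegral_weilArchDensity_mul_one_sub_cos_le (ha : 0 < a) {m : ℤ} (hm : 1 ≤ |π * m / a|) :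
    |∫ t in Ioc 0 (2 * a), weilArchDensity t * (1 - Real.cos (π * m / a * t))|
      ≤ (Real.log (5 / 4 + |π * m / a| / 2) + 8 - reDigammaQuarter 0) / 2 + 2 * weilArchDensity (2 * a) := by
  rw [setIntegral_weilArchDensity_mul_one_sub_cos ha m]
  set ω : ℝ := π * m / a with hω
  -- the Re ψ part
  have hlo : 0 ≤ reDigammaQuarter ω - reDigammaQuarter 0 := sub_nonneg.2 (reDigammaQuarter_zero_le ω)
  have hhi : reDigammaQuarter ω - reDigammaQuarter 0 ≤ Real.log (5 / 4 + |ω| / 2) + 8 - reDigammaQuarter 0 := by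
    linarith [reDigammaQuarter_le_log hm]
  have hA : |(reDigammaQuarter ω - reDigammaQuarter 0) / 2| ≤ (Real.log (5 / 4 + |ω| / 2) + 8 - reDigammaQuarter 0) / 2 := by
    rw [abs_of_nonneg (by positivity)]
    linarith
  -- the exponential tail
  have hE := hasSum_exp_neg_two_mul_digammaNode ha
  have hsum := summable_exp_mul_digammaTerm ha ω
  have hB : |∑' k : ℕ, Real.exp (-(2 * a * digammaNode k)) * (digammaTerm (digammaNode k) ω / 2)|
      ≤ 2 * weilArchDensity (2 * a) := by
    have h1 : |∑' k : ℕ, Real.exp (-(2 * a * digammaNode k)) * (digammaTerm (digammaNode k) ω / 2)|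
        ≤ ∑' k : ℕ, |Real.exp (-(2 * a * digammaNode k)) * (digammaTerm (digammaNode k) ω / 2)| := by
      have := norm_tsum_le_tsum_norm hsum.norm
      simpa only [Real.norm_eq_abs] using this
    refine h1.trans ?_
    have h2 : ∀ k, |Real.exp (-(2 * a * digammaNode k)) * (digammaTerm (digammaNode k) ω / 2)|
        ≤ 2 * Real.exp (-(2 * a * digammaNode k)) := fun k ↦ by
      rw [abs_mul, abs_of_pos (Real.exp_pos _), abs_div, abs_two]
      have := abs_digammaTerm_digammaNode_le ω k
      nlinarith [Real.exp_pos (-(2 * a * digammaNode k))]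
    calc ∑' k : ℕ, |Real.exp (-(2 * a * digammaNode k)) * (digammaTerm (digammaNode k) ω / 2)|
        ≤ ∑' k : ℕ, 2 * Real.exp (-(2 * a * digammaNode k)) :=
          Summable.tsum_le_tsum h2 hsum.abs (hE.summable.mul_left 2)
      _ = 2 * weilArchDensity (2 * a) := by rw [tsum_mul_left, hE.tsum_eq]
  have t := abs_sub ((reDigammaQuarter ω - reDigammaQuarter 0) / 2)
    (∑' k : ℕ, Real.exp (-(2 * a * digammaNode k)) * (digammaTerm (digammaNode k) ω / 2))
  linarith

end Summit.RiemannHypothesis.RiemannHypothesis.Theorems.WeilFormatC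

end
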